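import Mathlib
import Literature.Barriers.MatrixMultiplication.UniversalMethodBarrier
import Summits.MatrixMultiplication.MatrixMultiplication.Theorems.StrassenDefectJunkNecessaryLift

/-!
# No degeneration onto a concise tensor with fewer central triples

Support file 2/2 for item `JunkNecessary` of route StrassenDefect
(stmt-MatrixMultiplication-4079). Main result: `Central.not_polyDegeneratesTo_of_central` —
if `s` is concise in each leg, every central triple `(X, Y, Z)` of `s` (see
`…StrassenDefectJunkNecessaryLift`, `central`) with `X a₀ a₀ = 0` vanishes, and `t` (same index
types) has two central triples with linearly independent first components, then there is no
polynomial degeneration `t ⊵ s` (`PolyDegeneratesTo`, Alman 2021 §2.4 / Strassen–Bini).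
This is the tensor avatar of "the dimension of the centre of the associated algebra can only
grow under degeneration", proved here without topology or invariant theory:

1. a degeneration gives square matrices `P, Q, R` over `K[X]` and a tensor `S` over `K[X]` with
   `(P, Q, R) · t = X^h · S` and `S(0) = s` (`exists_lift_of_polyDegeneratesTo`);
2. conciseness of `s` forces `det P, det Q, det R ≠ 0` — otherwise a kernel vector over `K[X]`,
   read at its lowest-order coefficient, contradicts conciseness
   (`vec_eq_zero_of_sum_mul_eq_zero`);
3. adjugates transport central triples of `t` to central triples of `S` over `K[X]`,
   injectively and linearly;
4. the lowest-order coefficient of a central triple of `S` is a central triple of `s`, so a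
   central triple of `S` whose `(a₀, a₀)` entry vanishes is zero (`central_eq_zero`);
5. eliminating the `(a₀, a₀)` entry between the two transported triples contradicts their
   independence.

Also: `polyDegeneratesTo_reindex` (reindexing the source of a degeneration along bijections).
-/

-- single-conjunct summit: `Summit.<S>.<P>` repeats `MatrixMultiplication` by design (D-0017)
set_option linter.dupNamespace false

noncomputable section

namespace Summit.MatrixMultiplication.MatrixMultiplication.Theorems

open scoped BigOperators Polynomial
open Literature.Barriers.MatrixMultiplication

namespace Central

variable {ι κ μ ι' κ' μ' ι'' κ'' μ'' : Type*}

/-! ## Reindexing and the `lift` form of a polynomial degeneration -/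

/-- A polynomial degeneration `t ⊵ s` stays one after reindexing the source along bijections.
[folklore] -/
theorem polyDegeneratesTo_reindex {K : Type*} [CommSemiring K] [Fintype ι] [Fintype κ]
    [Fintype μ] [Fintype ι''] [Fintype κ''] [Fintype μ''] {t : ι → κ → μ → K}
    {s : ι' → κ' → μ' → K} (h : PolyDegeneratesTo t s) (e₁ : ι'' ≃ ι) (e₂ : κ'' ≃ κ)
    (e₃ : μ'' ≃ μ) : PolyDegeneratesTo (fun a b c => t (e₁ a) (e₂ b) (e₃ c)) s := by
  obtain ⟨n, A, B, C, hABC⟩ := h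
  refine ⟨n, fun a a' => A (e₁ a) a', fun b b' => B (e₂ b) b', fun c c' => C (e₃ c) c',
    fun a' b' c' j hj => ?_⟩
  rw [← hABC a' b' c' j hj]
  congr 1
  exact Fintype.sum_equiv e₁ _ _ fun a => Fintype.sum_equiv e₂ _ _ fun b =>
    Fintype.sum_equiv e₃ _ _ fun c => rfl

variable {K : Type*} [Field K]

/-- The `lift` form of a polynomial degeneration: matrices `P, Q, R` over `K[X]` and a tensor `S`
over `K[X]` with `(P, Q, R) · t = X^h · S` and `S(0) = s`. [folklore] -/
theorem exists_lift_of_polyDegeneratesTo [Fintype ι] [Fintype κ] [Fintype μ]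
    {t : ι → κ → μ → K} {s : ι' → κ' → μ' → K} (h : PolyDegeneratesTo t s) :
    ∃ (n : ℕ) (P : Matrix ι' ι K[X]) (Q : Matrix κ' κ K[X]) (Rm : Matrix μ' μ K[X])
      (S : ι' → κ' → μ' → K[X]),
      lift₁ P (lift₂ Q (lift₃ Rm fun a b c => Polynomial.C (t a b c))) =
          (Polynomial.X : K[X]) ^ n • S ∧
        ∀ a b c, (S a b c).coeff 0 = s a b c := by
  obtain ⟨n, A, B, C, hABC⟩ := h
  have hdvd : ∀ a' b' c', ∃ q : K[X],
      (∑ a, ∑ b, ∑ c, Polynomial.C (t a b c) * (A a a' * B b b' * C c c')) =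
        (Polynomial.X : K[X]) ^ n * q :=
    fun a' b' c' => Polynomial.X_pow_dvd_iff.mpr fun d hd => by
      have := hABC a' b' c' d hd.le
      rwa [if_neg hd.ne] at this
  choose S hS using hdvd
  refine ⟨n, Matrix.of fun a' a => A a a', Matrix.of fun b' b => B b b',
    Matrix.of fun c' c => C c c', S, ?_, fun a' b' c' => ?_⟩
  · funext a' b' c'
    rw [Pi.smul_apply, Pi.smul_apply, Pi.smul_apply, smul_eq_mul, ← hS]
    simp only [lift₁, lift₂, lift₃, Matrix.of_apply, Finset.mul_sum]
    exact Finset.sum_congr rfl fun _ _ => Finset.sum_congr rfl fun _ _ =>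
      Finset.sum_congr rfl fun _ _ => by ring
  · have h1 := hABC a' b' c' n le_rfl
    rw [if_pos rfl, hS] at h1
    have h2 := Polynomial.coeff_X_pow_mul (S a' b' c') n 0
    rw [zero_add] at h2
    rw [← h2, h1]

/-! ## Specialisation at `X = 0` (lowest-order coefficients) -/

/-- Lowest-order coefficient argument, vector form: if `∑ i, w i * s i j = 0` for all `j` forces
`w = 0` over `K`, and `S(0) = s`, then `∑ i, u i * S i j = 0` for all `j` forces `u = 0` over
`K[X]`. [folklore] -/
theorem vec_eq_zero_of_sum_mul_eq_zero {I J : Type*} [Fintype I] (S : I → J → K[X])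
    (s : I → J → K) (hS : ∀ i j, (S i j).coeff 0 = s i j)
    (hs : ∀ w : I → K, (∀ j, ∑ i, w i * s i j = 0) → w = 0)
    (u : I → K[X]) (hu : ∀ j, ∑ i, u i * S i j = 0) : u = 0 := by
  suffices H : ∀ o i, (u i).coeff o = 0 by
    funext i; ext o; simp [H]
  intro o
  induction o using Nat.strong_induction_on with
  | _ o ih =>
    have hdvd : ∀ i, ∃ q, u i = (Polynomial.X : K[X]) ^ o * q := fun i =>
      Polynomial.X_pow_dvd_iff.mpr fun d hd => ih d hd i
    choose v hv using hdvd
    have hv0 : ∀ j, ∑ i, v i * S i j = 0 := by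
      intro j
      have h1 : (Polynomial.X : K[X]) ^ o * ∑ i, v i * S i j = 0 := by
        rw [Finset.mul_sum, ← hu j]
        exact Finset.sum_congr rfl fun i _ => by rw [hv i]; ring
      exact (mul_eq_zero.mp h1).resolve_left (pow_ne_zero _ Polynomial.X_ne_zero)
    have hw : (fun i => (v i).coeff 0) = 0 := by
      refine hs _ fun j => ?_
      have := congr_arg (fun p : K[X] => p.coeff 0) (hv0 j)
      simpa only [Polynomial.finsetSum_coeff, Polynomial.mul_coeff_zero, hS,
        Polynomial.coeff_zero] using this
    intro i
    have h2 := Polynomial.coeff_X_pow_mul (v i) o 0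
    rw [zero_add, ← hv i] at h2
    rw [h2]
    exact congr_fun hw i

/-- Lowest-order coefficient argument for central triples: if every central triple `(X, Y, Z)`
of `s` with `X a₀ a₀ = 0` vanishes and `S(0) = s`, the same holds for central triples of `S`
over `K[X]`. [folklore] -/
theorem central_eq_zero [Fintype ι] [Fintype κ] [Fintype μ] (S : ι → κ → μ → K[X])
    (s : ι → κ → μ → K) (hS : ∀ a b c, (S a b c).coeff 0 = s a b c) (a₀ : ι)
    (hrig : ∀ (X : Matrix ι ι K) (Y : Matrix κ κ K) (Z : Matrix μ μ K),
      (X, Y, Z) ∈ central s → X a₀ a₀ = 0 → X = 0 ∧ Y = 0 ∧ Z = 0)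
    {P : Matrix ι ι K[X]} {Q : Matrix κ κ K[X]} {Rm : Matrix μ μ K[X]}
    (hc : (P, Q, Rm) ∈ central S) (h0 : P a₀ a₀ = 0) : P = 0 ∧ Q = 0 ∧ Rm = 0 := by
  suffices H : ∀ o, (∀ i j, (P i j).coeff o = 0) ∧ (∀ i j, (Q i j).coeff o = 0) ∧
      (∀ i j, (Rm i j).coeff o = 0) by
    refine ⟨?_, ?_, ?_⟩ <;> ext i j o
    · simpa using (H o).1 i j
    · simpa using (H o).2.1 i j
    · simpa using (H o).2.2 i j
  intro o
  induction o using Nat.strong_induction_on with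
  | _ o ih =>
    have hdP : ∀ i j, ∃ q, P i j = (Polynomial.X : K[X]) ^ o * q := fun i j =>
      Polynomial.X_pow_dvd_iff.mpr fun d hd => (ih d hd).1 i j
    have hdQ : ∀ i j, ∃ q, Q i j = (Polynomial.X : K[X]) ^ o * q := fun i j =>
      Polynomial.X_pow_dvd_iff.mpr fun d hd => (ih d hd).2.1 i j
    have hdR : ∀ i j, ∃ q, Rm i j = (Polynomial.X : K[X]) ^ o * q := fun i j =>
      Polynomial.X_pow_dvd_iff.mpr fun d hd => (ih d hd).2.2 i j
    choose P' hP' using hdP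
    choose Q' hQ' using hdQ
    choose R' hR' using hdR
    have hPe : P = (Polynomial.X : K[X]) ^ o • Matrix.of P' :=
      Matrix.ext fun i j => by simp [hP']
    have hQe : Q = (Polynomial.X : K[X]) ^ o • Matrix.of Q' :=
      Matrix.ext fun i j => by simp [hQ']
    have hRe : Rm = (Polynomial.X : K[X]) ^ o • Matrix.of R' :=
      Matrix.ext fun i j => by simp [hR']
    have hXo : (Polynomial.X : K[X]) ^ o ≠ 0 := pow_ne_zero _ Polynomial.X_ne_zero
    have hc' : (Matrix.of P', Matrix.of Q', Matrix.of R') ∈ central S := by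
      obtain ⟨h1, h2⟩ := hc
      dsimp only at h1 h2
      rw [hPe, hRe, lift₁_smul, lift₃_smul] at h1
      rw [hQe, hRe, lift₂_smul, lift₃_smul] at h2
      exact ⟨smul_right_injective _ hXo h1, smul_right_injective _ hXo h2⟩
    have hc0 := central_map (Polynomial.constantCoeff : K[X] →+* K) hc'
    have hSs : (fun a b c => (Polynomial.constantCoeff : K[X] →+* K) (S a b c)) = s := by
      funext a b c; simp [hS]
    rw [hSs] at hc0
    have hco : ∀ (p q : K[X]), p = (Polynomial.X : K[X]) ^ o * q → p.coeff o = q.coeff 0 := by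
      rintro p q rfl
      have h2 := Polynomial.coeff_X_pow_mul q o 0
      rwa [zero_add] at h2
    have h00 : (Matrix.of P').map (Polynomial.constantCoeff : K[X] →+* K) a₀ a₀ = 0 := by
      have := hco _ _ (hP' a₀ a₀)
      rw [h0, Polynomial.coeff_zero] at this
      simpa using this.symm
    obtain ⟨e1, e2, e3⟩ := hrig _ _ _ hc0 h00
    refine ⟨fun i j => ?_, fun i j => ?_, fun i j => ?_⟩
    · rw [hco _ _ (hP' i j)]
      simpa using congr_fun (congr_fun e1 i) j
    · rw [hco _ _ (hQ' i j)]
      simpa using congr_fun (congr_fun e2 i) j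
    · rw [hco _ _ (hR' i j)]
      simpa using congr_fun (congr_fun e3 i) j

/-! ## The main abstract theorem -/

/-- **No degeneration onto a tensor with fewer central triples.** Let `s` be concise in each
leg, suppose every central triple `(X, Y, Z)` of `s` with `X a₀ a₀ = 0` vanishes (so the central
triples of `s` form at most a line), and let `t` — on the same index types — carry two central
triples whose first components are linearly independent. Then `t` does not degenerate to `s`
(`PolyDegeneratesTo`, Alman 2021 §2.4 / Strassen). Elementary (adjugates over `K[X]` and
lowest-order coefficients). [folklore] -/
theorem not_polyDegeneratesTo_of_central [Fintype ι] [Fintype κ] [Fintype μ] [DecidableEq ι]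
    [DecidableEq κ] [DecidableEq μ] {t s : ι → κ → μ → K}
    (hs₁ : ∀ w : ι → K, (∀ b c, ∑ a, w a * s a b c = 0) → w = 0)
    (hs₂ : ∀ w : κ → K, (∀ a c, ∑ b, w b * s a b c = 0) → w = 0)
    (hs₃ : ∀ w : μ → K, (∀ a b, ∑ c, w c * s a b c = 0) → w = 0)
    (a₀ : ι)
    (hrig : ∀ (X : Matrix ι ι K) (Y : Matrix κ κ K) (Z : Matrix μ μ K),
      (X, Y, Z) ∈ central s → X a₀ a₀ = 0 → X = 0 ∧ Y = 0 ∧ Z = 0)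
    {X₁ X₂ : Matrix ι ι K} {Y₁ Y₂ : Matrix κ κ K} {Z₁ Z₂ : Matrix μ μ K}
    (h₁ : (X₁, Y₁, Z₁) ∈ central t) (h₂ : (X₂, Y₂, Z₂) ∈ central t)
    (hind : ∀ f g : K, f • X₁ + g • X₂ = 0 → f = 0 ∧ g = 0) :
    ¬ PolyDegeneratesTo t s := by
  intro hdeg
  obtain ⟨n, P, Q, Rm, S, hT, hS⟩ := exists_lift_of_polyDegeneratesTo hdeg
  set tX : ι → κ → μ → K[X] := fun a b c => Polynomial.C (t a b c) with htX
  have hXn : (Polynomial.X : K[X]) ^ n ≠ 0 := pow_ne_zero _ Polynomial.X_ne_zero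
  have hT₂ : lift₂ Q (lift₁ P (lift₃ Rm tX)) = (Polynomial.X : K[X]) ^ n • S := by
    rw [← lift₁_lift₂]; exact hT
  have hT₃ : lift₃ Rm (lift₁ P (lift₂ Q tX)) = (Polynomial.X : K[X]) ^ n • S := by
    rw [← lift₁_lift₃, ← lift₂_lift₃]; exact hT
  -- (1) conciseness of `s` forces the three determinants to be non-zero
  have hP : P.det ≠ 0 := by
    intro hdet
    obtain ⟨u, hu0, huP⟩ := Matrix.exists_vecMul_eq_zero_iff.mpr hdet
    refine hu0 (vec_eq_zero_of_sum_mul_eq_zero (J := κ × μ) (fun i j => S i j.1 j.2)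
      (fun i j => s i j.1 j.2) (fun i j => hS i j.1 j.2)
      (fun w hw => hs₁ w fun b c => hw (b, c)) u fun j => ?_)
    have key : ∑ a, u a * lift₁ P (lift₂ Q (lift₃ Rm tX)) a j.1 j.2 = 0 := by
      calc ∑ a, u a * lift₁ P (lift₂ Q (lift₃ Rm tX)) a j.1 j.2
          = ∑ x, Matrix.vecMul u P x * lift₂ Q (lift₃ Rm tX) x j.1 j.2 := by
            simp only [lift₁, Matrix.vecMul, dotProduct, Finset.mul_sum, Finset.sum_mul]
            exact Finset.sum_comm.trans (Finset.sum_congr rfl fun _ _ =>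
              Finset.sum_congr rfl fun _ _ => by ring)
        _ = 0 := by simp [huP]
    rw [hT] at key
    have key' : (Polynomial.X : K[X]) ^ n * ∑ a, u a * S a j.1 j.2 = 0 := by
      rw [Finset.mul_sum, ← key]
      exact Finset.sum_congr rfl fun a _ => by simp only [Pi.smul_apply, smul_eq_mul]; ring
    exact (mul_eq_zero.mp key').resolve_left hXn
  have hQ : Q.det ≠ 0 := by
    intro hdet
    obtain ⟨u, hu0, huQ⟩ := Matrix.exists_vecMul_eq_zero_iff.mpr hdet
    refine hu0 (vec_eq_zero_of_sum_mul_eq_zero (J := ι × μ) (fun i j => S j.1 i j.2)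
      (fun i j => s j.1 i j.2) (fun i j => hS j.1 i j.2)
      (fun w hw => hs₂ w fun a c => hw (a, c)) u fun j => ?_)
    have key : ∑ b, u b * lift₂ Q (lift₁ P (lift₃ Rm tX)) j.1 b j.2 = 0 := by
      calc ∑ b, u b * lift₂ Q (lift₁ P (lift₃ Rm tX)) j.1 b j.2
          = ∑ y, Matrix.vecMul u Q y * lift₁ P (lift₃ Rm tX) j.1 y j.2 := by
            simp only [lift₂, Matrix.vecMul, dotProduct, Finset.mul_sum, Finset.sum_mul]
            exact Finset.sum_comm.trans (Finset.sum_congr rfl fun _ _ =>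
              Finset.sum_congr rfl fun _ _ => by ring)
        _ = 0 := by simp [huQ]
    rw [hT₂] at key
    have key' : (Polynomial.X : K[X]) ^ n * ∑ b, u b * S j.1 b j.2 = 0 := by
      rw [Finset.mul_sum, ← key]
      exact Finset.sum_congr rfl fun a _ => by simp only [Pi.smul_apply, smul_eq_mul]; ring
    exact (mul_eq_zero.mp key').resolve_left hXn
  have hR : Rm.det ≠ 0 := by
    intro hdet
    obtain ⟨u, hu0, huR⟩ := Matrix.exists_vecMul_eq_zero_iff.mpr hdet
    refine hu0 (vec_eq_zero_of_sum_mul_eq_zero (J := ι × κ) (fun i j => S j.1 j.2 i)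
      (fun i j => s j.1 j.2 i) (fun i j => hS j.1 j.2 i)
      (fun w hw => hs₃ w fun a b => hw (a, b)) u fun j => ?_)
    have key : ∑ c, u c * lift₃ Rm (lift₁ P (lift₂ Q tX)) j.1 j.2 c = 0 := by
      calc ∑ c, u c * lift₃ Rm (lift₁ P (lift₂ Q tX)) j.1 j.2 c
          = ∑ z, Matrix.vecMul u Rm z * lift₁ P (lift₂ Q tX) j.1 j.2 z := by
            simp only [lift₃, Matrix.vecMul, dotProduct, Finset.mul_sum, Finset.sum_mul]
            exact Finset.sum_comm.trans (Finset.sum_congr rfl fun _ _ =>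
              Finset.sum_congr rfl fun _ _ => by ring)
        _ = 0 := by simp [huR]
    rw [hT₃] at key
    have key' : (Polynomial.X : K[X]) ^ n * ∑ c, u c * S j.1 j.2 c = 0 := by
      rw [Finset.mul_sum, ← key]
      exact Finset.sum_congr rfl fun a _ => by simp only [Pi.smul_apply, smul_eq_mul]; ring
    exact (mul_eq_zero.mp key').resolve_left hXn
  -- (2) transport of central triples along adjugates
  let Θ₁ : Matrix ι ι K[X] → Matrix ι ι K[X] := fun M => (Q.det * Rm.det) • (P * M * P.adjugate)
  let Θ₂ : Matrix κ κ K[X] → Matrix κ κ K[X] := fun M => (P.det * Rm.det) • (Q * M * Q.adjugate)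
  let Θ₃ : Matrix μ μ K[X] → Matrix μ μ K[X] :=
    fun M => (P.det * Q.det) • (Rm * M * Rm.adjugate)
  have hΘ₁P : ∀ M, Θ₁ M * P = (Q.det * Rm.det * P.det) • (P * M) := fun M => by
    simp only [Θ₁, Matrix.smul_mul, Matrix.mul_assoc, Matrix.adjugate_mul, Matrix.mul_smul,
      Matrix.mul_one, smul_smul]
  have hΘ₂Q : ∀ M, Θ₂ M * Q = (P.det * Rm.det * Q.det) • (Q * M) := fun M => by
    simp only [Θ₂, Matrix.smul_mul, Matrix.mul_assoc, Matrix.adjugate_mul, Matrix.mul_smul,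
      Matrix.mul_one, smul_smul]
  have hΘ₃R : ∀ M, Θ₃ M * Rm = (P.det * Q.det * Rm.det) • (Rm * M) := fun M => by
    simp only [Θ₃, Matrix.smul_mul, Matrix.mul_assoc, Matrix.adjugate_mul, Matrix.mul_smul,
      Matrix.mul_one, smul_smul]
  have hl₁ : ∀ A : Matrix ι ι K[X], lift₁ (Θ₁ A) (lift₁ P (lift₂ Q (lift₃ Rm tX))) =
      (Q.det * Rm.det * P.det) • lift₁ P (lift₂ Q (lift₃ Rm (lift₁ A tX))) := fun A => by
    rw [lift₁_lift₁, hΘ₁P, lift₁_smul, ← lift₁_lift₁, lift₁_lift₂ A, lift₁_lift₃ A]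
  have hl₂ : ∀ B : Matrix κ κ K[X], lift₂ (Θ₂ B) (lift₁ P (lift₂ Q (lift₃ Rm tX))) =
      (P.det * Rm.det * Q.det) • lift₁ P (lift₂ Q (lift₃ Rm (lift₂ B tX))) := fun B => by
    rw [← lift₁_lift₂ P (Θ₂ B), lift₂_lift₂ (Θ₂ B) Q, hΘ₂Q, lift₂_smul, ← lift₂_lift₂,
      lift₂_lift₃ B, lift₁_smul_right]
  have hl₃ : ∀ C : Matrix μ μ K[X], lift₃ (Θ₃ C) (lift₁ P (lift₂ Q (lift₃ Rm tX))) =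
      (P.det * Q.det * Rm.det) • lift₁ P (lift₂ Q (lift₃ Rm (lift₃ C tX))) := fun C => by
    rw [← lift₁_lift₃ P (Θ₃ C), ← lift₂_lift₃ Q (Θ₃ C), lift₃_lift₃ (Θ₃ C) Rm, hΘ₃R, lift₃_smul,
      ← lift₃_lift₃, lift₂_smul_right, lift₁_smul_right]
  have hcent : ∀ {A : Matrix ι ι K[X]} {B : Matrix κ κ K[X]} {C : Matrix μ μ K[X]},
      (A, B, C) ∈ central tX → (Θ₁ A, Θ₂ B, Θ₃ C) ∈ central S := by
    intro A B C hABC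
    obtain ⟨h1, h2⟩ := hABC
    dsimp only at h1 h2
    rw [← mem_central_smul_iff hXn, ← hT]
    refine ⟨?_, ?_⟩
    · show lift₁ (Θ₁ A) _ = lift₃ (Θ₃ C) _
      rw [hl₁, hl₃, h1]; congr 1; ring
    · show lift₂ (Θ₂ B) _ = lift₃ (Θ₃ C) _
      rw [hl₂, hl₃, h2]; congr 1; ring
  -- (3) `Θ₁` is injective and linear, so independence survives
  have hΘ₁_lin : ∀ (f g : K[X]) (M₁ M₂ : Matrix ι ι K[X]),
      f • Θ₁ M₁ + g • Θ₁ M₂ = Θ₁ (f • M₁ + g • M₂) := by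
    intro f g M₁ M₂
    simp only [Θ₁, Matrix.mul_add, Matrix.add_mul, Matrix.mul_smul, Matrix.smul_mul, smul_add,
      smul_smul, mul_comm f, mul_comm g]
  have hadj : ∀ N : Matrix ι ι K[X], P.adjugate * (P * N) = P.det • N := fun N => by
    rw [← Matrix.mul_assoc, Matrix.adjugate_mul, Matrix.smul_mul, Matrix.one_mul]
  have hΘ₁_inj : ∀ M, Θ₁ M = 0 → M = 0 := by
    intro M hM
    have h1 : P.adjugate * Θ₁ M * P = (Q.det * Rm.det * (P.det * P.det)) • M := by
      simp only [Θ₁, Matrix.mul_smul, Matrix.smul_mul, Matrix.mul_assoc, Matrix.adjugate_mul,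
        Matrix.mul_one, hadj, smul_smul]
      congr 1; ring
    rw [hM, Matrix.mul_zero, Matrix.zero_mul] at h1
    have hc : Q.det * Rm.det * (P.det * P.det) ≠ 0 :=
      mul_ne_zero (mul_ne_zero hQ hR) (mul_ne_zero hP hP)
    refine Matrix.ext fun i j => ?_
    have := congr_fun (congr_fun h1 i) j
    simp only [Matrix.zero_apply, Matrix.smul_apply, smul_eq_mul] at this
    simpa using (mul_eq_zero.mp this.symm).resolve_left hc
  have hind' : ∀ f g : K[X], f • Θ₁ (X₁.map Polynomial.C) + g • Θ₁ (X₂.map Polynomial.C) = 0 →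
      f = 0 ∧ g = 0 := by
    intro f g hfg
    rw [hΘ₁_lin] at hfg
    have hM := hΘ₁_inj _ hfg
    have hcoef : ∀ k, f.coeff k • X₁ + g.coeff k • X₂ = 0 := by
      intro k
      ext i j
      have := congr_arg (fun p : K[X] => p.coeff k) (congr_fun (congr_fun hM i) j)
      simpa [Matrix.add_apply, Matrix.smul_apply, smul_eq_mul, Polynomial.coeff_mul_C] using this
    constructor
    · ext k; simpa using (hind _ _ (hcoef k)).1
    · ext k; simpa using (hind _ _ (hcoef k)).2
  -- (4) the two transported triples and the 2 × 2 elimination at `a₀`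
  have w₁ : (Θ₁ (X₁.map Polynomial.C), Θ₂ (Y₁.map Polynomial.C), Θ₃ (Z₁.map Polynomial.C)) ∈
      central S := hcent (central_map (Polynomial.C : K →+* K[X]) h₁)
  have w₂ : (Θ₁ (X₂.map Polynomial.C), Θ₂ (Y₂.map Polynomial.C), Θ₃ (Z₂.map Polynomial.C)) ∈
      central S := hcent (central_map (Polynomial.C : K →+* K[X]) h₂)
  have hv := central_lincomb w₁ w₂ (Θ₁ (X₂.map Polynomial.C) a₀ a₀)
    (-(Θ₁ (X₁.map Polynomial.C) a₀ a₀))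
  have hv0 : (Θ₁ (X₂.map Polynomial.C) a₀ a₀ • Θ₁ (X₁.map Polynomial.C) +
      (-(Θ₁ (X₁.map Polynomial.C) a₀ a₀)) • Θ₁ (X₂.map Polynomial.C)) a₀ a₀ = 0 := by
    simp only [Matrix.add_apply, Matrix.smul_apply, smul_eq_mul]; ring
  have hX0 := (central_eq_zero S s hS a₀ hrig hv hv0).1
  obtain ⟨hf0, -⟩ := hind' _ _ hX0
  have hX₂0 := (central_eq_zero S s hS a₀ hrig w₂ hf0).1
  have h01 := hind' 0 1 (by rw [hX₂0]; simp)
  exact one_ne_zero h01.2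

end Central

end Summit.MatrixMultiplication.MatrixMultiplication.Theorems
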